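import Literature.MathematicalPhysics.QuantumLattice.HubbardTTPrimeThermalEntropyRows
import Literature.MathematicalPhysics.QuantumLattice.HubbardTorusMarkovClusterPressureTorusLimit
import HarnessLib

/-!
# The entropy row («ent») of the canonical sector Gibbs state with a PRESSURE-FLOOR input

Topic `MathematicalPhysics/QuantumLattice`; companion of `TorusSectorGibbsEntropyRow(Limit).lean`. There the
thermodynamic input of the row is the zero-entropy bound `β(E_β − E₀) ≤ S(ρ_{L,β})` (`log Z_K ≥ −βE₀`), so the
torus-limit row reads `e_Φ(ω) − Re ω_B(G)/(β|B|) ≤ e(t,t',U,n) + log Tr e^{−G}/(β|B|)` with the GROUND-STATE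
energy density `e(n)` on the right. The identity `S(ρ_{L,β}) = log Z_K(L) + β E_β(L)`
(`vonNeumannEntropy_sectorGibbsDensityTT'`) allows ANY certified lower bound on the canonical pressure at the SAME
`β` to take the place of `−β e(n)`:

* §1 `InfVolFermionState.IsTorusLimitOfMixture.mul_meanEnergy_add_mul_re_expect_le_of_eventually_subseq` — the
  row passage of `TorusLimitOfMixturesLimsup.lean` with the finite-volume rows required only ALONG THE SUBSEQUENCE
  `Ls` defining the torus limit (pressure floors from box tilings hold only on box-compatible tori);
* §2 `sectorGibbs_energy_add_log_partitionFn_le_box` (finite volume, identity form):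
  `β E_β(L) + log Re Z_K(L) ≤ N_L·(Σ_i p_{L,i} Re torusAvgExpectAt L B G ψ_{L,i} + log Re Tr e^{−G}) + (L² − N_L|B|)·log 4`;
* §3 `InfVolFermionState.IsTorusLimitOfMixture.meanEnergy_sub_re_expect_div_le_of_sectorGibbs_box_of_pressureFloor`:
  for every torus limit `ω` of the canonical sector Gibbs states at `β > 0` along `Ls → ∞` (`0 ≤ n ≤ 2`) and every
  `W` with `∀ ε > 0, ∀ᶠ j, (W − ε)(Ls j)² ≤ log Re Z_β^{sector}(Ls j)`:
  `e_Φ(ω) − Re ω_B(G)/(β|B|) ≤ −W/β + log Re Tr e^{−G}/(β|B|)`;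
* §4 the same as the extra row `0 ≤ Re ω_{Λ'}((f + c)·1 − Γ E_Φ + (1/(β|B|))·Γ_{B⊆Λ'} G)` of the thermal reader
  for any `f ≥ −W/β`, `c ≥ log Re Tr e^{−G}/(β|B|)`.

Admissible `W`: the zero-entropy cold input `W = −β e(n)` (`eventually_neg_mul_le_log_partitionFn_sectorHamiltonianTT'`,
recovering the old row), the type-class certificate C2 (`eventually_typeFreeEntropy_mul_sq_le_log_partitionFn`,
`TorusSectorPressureTypeBound.lean`), or any future variational free-energy certificate `f⁺ = −W/β ≥ f(β)`.
Everything is PROVED; no definition, no named fact.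

References: Israel 1979 Lemma II.3.1 / §I.3 eq. (26) [Israel1979]; Araki–Moriya 2003 Thm. 3.8/§10
[ArakiMoriya2003]; Bratteli–Robinson I §4.3.1 [BratteliRobinsonI1987]; Friedli–Velenik 2017 §6.9 [FriedliVelenik2017].
-/

noncomputable section

namespace Literature.MathematicalPhysics.QuantumLattice

open Matrix Finset HubbardWave0 Literature.Probability.LatticeModels ThermodynamicLimit
open Literature.InformationTheory.Entropy (vonNeumannEntropy)
open _root_.Filter
open scoped _root_.Topology ComplexOrder BigOperators

/-! ### §1 Row passage along the subsequence -/

namespace InfVolFermionState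

/-- **Finite-volume rows along the defining subsequence pass to the torus limit.** Let `ω` be a torus limit of
the mixtures `(p_{L,i}, ψ_{L,i})` along `Ls → ∞`, `A ∈ 𝔄_Λ`, `a, κ, c` reals and `g : ℕ → ℝ` a reference sequence
(indexed like `Ls`) with `g j → γ`. If for every `ε > 0`, eventually in `j`,
`a · Σ_i p_{Ls j,i} Re⟨ψ, H_{Ls j}(t,t',U) ψ⟩/(Ls j)² + κ · Re Σ_i p_{Ls j,i} torusAvgExpect (Ls j) Λ A ψ_{Ls j,i} ≤ g j + c + ε`,
then `a · e_{Φ(t,t',U)}(ω) + κ · Re ω_Λ(A) ≤ γ + c`. [cite: BratteliRobinsonI1987, §4.3.1 (PDF pp. 373–375)] -/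
theorem IsTorusLimitOfMixture.mul_meanEnergy_add_mul_re_expect_le_of_eventually_subseq
    (t t' U : ℝ) {ω : InfVolFermionState 2} {m : ℕ → ℕ} {p : ∀ L, Fin (m L) → ℝ}
    {ψ : ∀ L, Fin (m L) → Fock (Orb (FermionTorus 2 L))} {Ls : ℕ → ℕ}
    (h : ω.IsTorusLimitOfMixture m p ψ Ls) (hLs : Tendsto Ls atTop atTop)
    (Λ : Finset (Site 2)) (A : FermionOp Λ) {a κ c γ : ℝ} {g : ℕ → ℝ} (hg : Tendsto g atTop (𝓝 γ))
    (hfin : ∀ ε : ℝ, 0 < ε → ∀ᶠ j in atTop,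
      a * (∑ i, p (Ls j) i *
          ((QuantumLattice.expect (hubbardTorusTT' (Ls j) t t' U) (ψ (Ls j) i)).re / (Ls j : ℝ) ^ 2)) +
          κ * (∑ i, (p (Ls j) i : ℂ) * torusAvgExpect (Ls j) Λ A (ψ (Ls j) i)).re ≤ g j + c + ε) :
    a * ω.meanEnergy (hubbardTTPrimeFermionInteraction t t' U) 1 + κ * (ω.expect Λ A).re ≤ γ + c := by
  have hE := h.tendsto_meanEnergy_hubbardTTPrime t t' U hLs
  have hA : Tendsto (fun j => (∑ i, (p (Ls j) i : ℂ) * torusAvgExpect (Ls j) Λ A (ψ (Ls j) i)).re) atTop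
      (𝓝 ((ω.expect Λ A).re)) := (Complex.continuous_re.tendsto _).comp (h Λ A)
  have hF := (hE.const_mul a).add (hA.const_mul κ)
  have hεle : ∀ ε : ℝ, 0 < ε →
      a * ω.meanEnergy (hubbardTTPrimeFermionInteraction t t' U) 1 + κ * (ω.expect Λ A).re ≤ γ + c + ε := by
    intro ε hε
    have hG : Tendsto (fun j => g j + c + ε) atTop (𝓝 (γ + c + ε)) := (hg.add_const c).add_const ε
    exact le_of_tendsto_of_tendsto hF hG (hfin ε hε)
  by_contra hlt
  push Not at hlt
  have h2 := hεle ((a * ω.meanEnergy (hubbardTTPrimeFermionInteraction t t' U) 1 + κ * (ω.expect Λ A).re -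
    (γ + c)) / 2) (by linarith)
  linarith

end InfVolFermionState

/-! ### §2 Finite volume: the row in identity form -/

section Finite

variable (L : ℕ) [NeZero L]

/-- **Finite-volume entropy row of the canonical sector Gibbs state, identity form.** For `0 ≤ n ≤ 2`, a
rectangle `B = ∏_i [0,m_i)` with `m_i ≤ L`, and a Hermitian witness `G ∈ 𝔄_B`:
`β E_β(L) + log Re Z_K(L) ≤ N_L · (Σ_i p_{L,i} Re torusAvgExpectAt L B G ψ_{L,i} + log Re Tr e^{−G}) + (L² − N_L·∏m_i)·log 4`
(`S(ρ_{L,β}) = log Z_K + β E_β`; box subadditivity for the even TI density `ρ_{L,β}`; Klein with the witness on the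
box; translation invariance). [cite: Israel1979, Lemma II.3.1] [cite: ArakiMoriya2003, Theorem 3.8 and §10] -/
theorem sectorGibbs_energy_add_log_partitionFn_le_box (t t' U : ℝ) {n : ℝ} (hn0 : 0 ≤ n) (hn2 : n ≤ 2)
    (β : ℝ) {m : Fin 2 → ℕ} (hmL : ∀ i, m i ≤ L) {G : FermionOp (halfOpenRect m)} (hG : G.IsHermitian) :
    β * (∑ i, sectorGibbsWeightTT' β t t' U n L i *
          (expect (hubbardTorusTT' L t t' U) (sectorGibbsVectorTT' t t' U n L i)).re) +
        Real.log (partitionFn β (sectorHamiltonianTT' t t' U n L)).re ≤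
      (#(rectTilingVecs m L) : ℝ) *
          (∑ i, sectorGibbsWeightTT' β t t' U n L i *
              (torusAvgExpectAt L (halfOpenRect m) G (sectorGibbsVectorTT' t t' U n L i)).re +
            Real.log (partitionFn 1 G).re) +
        ((L : ℝ) ^ 2 - (#(rectTilingVecs m L) : ℝ) * (∏ i, (m i : ℝ))) * Real.log 4 := by
  set ρ := sectorGibbsDensityTT' L β t t' U n with hρ
  have hρpsd : ρ.PosSemidef := posSemidef_sectorGibbsDensityTT' L β t t' U n
  have hρtr : ρ.trace = 1 := trace_sectorGibbsDensityTT' L β t t' U hn0 hn2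
  -- thermodynamics: `S(ρ) = log Z_K + β E_β`
  have h1 : vonNeumannEntropy ρ = Real.log (partitionFn β (sectorHamiltonianTT' t t' U n L)).re +
      β * (∑ i, sectorGibbsWeightTT' β t t' U n L i *
        (expect (hubbardTorusTT' L t t' U) (sectorGibbsVectorTT' t t' U n L i)).re) := by
    rw [hρ, vonNeumannEntropy_sectorGibbsDensityTT' L β t t' U hn0 hn2,
      ← re_trace_sectorGibbsDensityTT'_mul_hubbardTorusTT', re_trace_sectorGibbsDensityTT'_mul]
  -- box subadditivity
  have h2 := torus_vonNeumannEntropy_le_card_mul_box L hρpsd hρtr (parityAut_sectorGibbsDensityTT' L β t t' U n)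
    (relabel_translate_sectorGibbsDensityTT' L β t t' U n) hmL
  -- Klein on the box, with the witness expectation as a torus average
  have h3 := vonNeumannEntropy_fermionPartialTrace_le_re_trace_mul_add
    (PolySite.toTorusEmb L (injOn_proj_halfOpenRect L hmL)) hρpsd hρtr hG
  rw [re_trace_fermionEmbed_toTorusEmb_mul_sectorGibbsDensityTT'] at h3
  have hN : (0 : ℝ) ≤ (#(rectTilingVecs m L) : ℝ) := Nat.cast_nonneg _
  have h4 := mul_le_mul_of_nonneg_left h3 hN
  linarith

end Finite

/-! ### §3 The thermodynamic limit with a pressure floor -/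

section Limit

/-- From `βE + ℓ ≤ N(A + lz) + (L² − N P)·l₄`, `(W − ε₁)L² ≤ ℓ`, `N P ≤ L²`, `|A| ≤ M` and the smallness of
`δ = 1/P − N/L²`: `E/L² − A/(βP) ≤ −W/β + lz/(βP) + (ε₁/β + δ(P l₄ + M + |lz|)/β)`. [folklore] -/
private theorem row_algebra_pressure {β P Lsq N E ℓ W ε₁ A lz M δ l4 : ℝ} (hβ : 0 < β) (hL : 0 < Lsq)
    (hP : 0 < P) (hrow : β * E + ℓ ≤ N * (A + lz) + (Lsq - N * P) * l4) (hW : (W - ε₁) * Lsq ≤ ℓ)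
    (hNP : N * P ≤ Lsq) (hA : |A| ≤ M) (hδ : δ = 1 / P - N / Lsq) :
    E / Lsq - 1 / (β * P) * A ≤ -W / β + lz / (β * P) + (ε₁ / β + δ * (P * l4 + M + |lz|) / β) := by
  have hδ0 : 0 ≤ δ := by
    rw [hδ, sub_nonneg, div_le_div_iff₀ hL hP, one_mul]
    exact hNP
  have e1 : N - Lsq / P = -(Lsq * δ) := by rw [hδ]; field_simp; ring
  have e2 : Lsq - N * P = P * (Lsq * δ) := by rw [hδ]; field_simp
  have hLδ : 0 ≤ Lsq * δ := mul_nonneg hL.le hδ0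
  have hA' : -A ≤ M := (neg_le_abs A).trans hA
  have hlz : -lz ≤ |lz| := neg_le_abs lz
  have key : (N - Lsq / P) * A + (N - Lsq / P) * lz + (Lsq - N * P) * l4 ≤ Lsq * (δ * (P * l4 + M + |lz|)) := by
    rw [e1, e2]
    have h1 : -(Lsq * δ) * A ≤ Lsq * δ * M := by
      rw [neg_mul, ← mul_neg]; exact mul_le_mul_of_nonneg_left hA' hLδ
    have h2 : -(Lsq * δ) * lz ≤ Lsq * δ * |lz| := by
      rw [neg_mul, ← mul_neg]; exact mul_le_mul_of_nonneg_left hlz hLδ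
    nlinarith
  have hβL : 0 < β * Lsq := mul_pos hβ hL
  rw [show E / Lsq - 1 / (β * P) * A = (β * E - Lsq / P * A) / (β * Lsq) by field_simp,
    show -W / β + lz / (β * P) + (ε₁ / β + δ * (P * l4 + M + |lz|) / β) =
      (-(W - ε₁) * Lsq + Lsq / P * lz + Lsq * (δ * (P * l4 + M + |lz|))) / (β * Lsq) by field_simp; ring,
    div_le_div_iff_of_pos_right hβL]
  nlinarith

namespace InfVolFermionState

/-- **The ENTROPY ROW for thermal torus limits with a pressure-floor input.** Let `ω` be a torus limit of the
canonical `(rectN n L, S^z = 0)` Gibbs states of `hubbardTorusTT' L t t' U` at inverse temperature `β > 0` along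
`Ls → ∞` (`0 ≤ n ≤ 2`), `B = ∏_i [0,m_i)` a rectangle (`m_i > 0`), `G ∈ 𝔄_B` a Hermitian witness, and `W` a real
with `∀ ε > 0, ∀ᶠ j, (W − ε)·(Ls j)² ≤ log Re Z_β(sectorHamiltonianTT' t t' U n (Ls j))` (a certified floor on the
canonical pressure at `β` along the tori defining `ω`). Then
`e_{Φ(t,t',U)}(ω) − Re ω_B(G)/(β|B|) ≤ −W/β + log Re Tr e^{−G}/(β|B|)` — `e − T·s ≤ f⁺ := −W/β` with
`s ≤ (⟨G⟩ + log Tr e^{−G})/|B|`. [cite: Israel1979, Lemma II.3.1] [cite: ArakiMoriya2003, Theorem 3.8 and §10] -/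
theorem IsTorusLimitOfMixture.meanEnergy_sub_re_expect_div_le_of_sectorGibbs_box_of_pressureFloor
    (t t' U : ℝ) {n : ℝ} (hn0 : 0 ≤ n) (hn2 : n ≤ 2) {β : ℝ} (hβ : 0 < β)
    {ω : InfVolFermionState 2} {Ls : ℕ → ℕ}
    (h : ω.IsTorusLimitOfMixture (sectorGibbsCount n) (fun L => sectorGibbsWeightTT' β t t' U n L)
      (fun L => sectorGibbsVectorTT' t t' U n L) Ls)
    (hLs : Tendsto Ls atTop atTop) {W : ℝ}
    (hW : ∀ ε : ℝ, 0 < ε → ∀ᶠ j in atTop,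
      (W - ε) * (Ls j : ℝ) ^ 2 ≤ Real.log (partitionFn β (sectorHamiltonianTT' t t' U n (Ls j))).re)
    {m : Fin 2 → ℕ} (hm : ∀ i, 0 < m i) {G : FermionOp (halfOpenRect m)} (hG : G.IsHermitian) :
    ω.meanEnergy (hubbardTTPrimeFermionInteraction t t' U) 1 -
        1 / (β * ∏ i, (m i : ℝ)) * (ω.expect (halfOpenRect m) G).re ≤
      -W / β + Real.log (partitionFn 1 G).re / (β * ∏ i, (m i : ℝ)) := by
  set P : ℝ := ∏ i, (m i : ℝ) with hPdef
  have hP : 0 < P := Finset.prod_pos fun i _ => by exact_mod_cast hm i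
  set M : ℝ := ∑ s, ∑ t, ‖G s t‖ with hMdef
  set lz : ℝ := Real.log (partitionFn 1 G).re with hlz
  set K : ℝ := P * Real.log 4 + M + |lz| with hK
  -- `δ_j = 1/P − N_{Ls j}/(Ls j)² → 0` along the subsequence
  have hδ : Tendsto (fun j : ℕ => (1 / P - (#(rectTilingVecs m (Ls j)) : ℝ) / (Ls j : ℝ) ^ 2) * K / β) atTop
      (𝓝 0) := by
    have h1 := ((tendsto_const_nhds (x := 1 / P)).sub (tendsto_card_rectTilingVecs_div_sq hm)).comp hLs
    rw [sub_self] at h1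
    have h2 := (h1.mul_const K).div_const β
    rw [zero_mul, zero_div] at h2
    exact h2
  have key := h.mul_meanEnergy_add_mul_re_expect_le_of_eventually_subseq t t' U hLs (halfOpenRect m) G
    (a := 1) (κ := -(1 / (β * P))) (c := lz / (β * P)) (γ := -W / β) (g := fun _ => -W / β)
    tendsto_const_nhds ?_
  · simpa [sub_eq_add_neg, hPdef, hlz] using key
  intro ε hε
  have hε2 : 0 < ε / 2 := by linarith
  have hβε : 0 < β * (ε / 2) := mul_pos hβ hε2
  filter_upwards [hδ.eventually (gt_mem_nhds hε2), hW (β * (ε / 2)) hβε,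
    hLs.eventually_ge_atTop (m 0 + m 1 + 1)] with j hδj hWj hLj
  haveI : NeZero (Ls j) := ⟨by omega⟩
  have hmL : ∀ i, m i ≤ Ls j := fun i => by fin_cases i <;> simp <;> omega
  have hL0 : (0 : ℝ) < (Ls j : ℝ) := Nat.cast_pos.2 (NeZero.pos (Ls j))
  have hLsq : (0 : ℝ) < (Ls j : ℝ) ^ 2 := by positivity
  -- the finite-volume row at side `Ls j`
  have hrow := sectorGibbs_energy_add_log_partitionFn_le_box (Ls j) t t' U hn0 hn2 β hmL hG
  have havg : (∑ i, (sectorGibbsWeightTT' β t t' U n (Ls j) i : ℂ) *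
        torusAvgExpect (Ls j) (halfOpenRect m) G (sectorGibbsVectorTT' t t' U n (Ls j) i)).re =
      ∑ i, sectorGibbsWeightTT' β t t' U n (Ls j) i *
        (torusAvgExpectAt (Ls j) (halfOpenRect m) G (sectorGibbsVectorTT' t t' U n (Ls j) i)).re := by
    rw [Complex.re_sum]
    refine Finset.sum_congr rfl fun i _ => ?_
    rw [Complex.re_ofReal_mul, torusAvgExpect_eq]
  have hA : |∑ i, sectorGibbsWeightTT' β t t' U n (Ls j) i *
      (torusAvgExpectAt (Ls j) (halfOpenRect m) G (sectorGibbsVectorTT' t t' U n (Ls j) i)).re| ≤ M := by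
    have h := abs_sum_mul_re_torusAvgExpect_le (Ls j) (halfOpenRect m) G
      (fun i => sectorGibbsWeightTT' β t t' U n (Ls j) i) (fun i => sectorGibbsVectorTT' t t' U n (Ls j) i)
      (fun i => sectorGibbsWeightTT'_nonneg β t t' U n (Ls j) i) (sum_sectorGibbsWeightTT' β t t' U hn0 hn2 (Ls j))
      (fun i => star_sectorGibbsVectorTT'_dotProduct_self t t' U n (Ls j) i)
    simp_rw [torusAvgExpect_eq] at h
    exact h
  have henergy : ∑ i, sectorGibbsWeightTT' β t t' U n (Ls j) i *
        ((QuantumLattice.expect (hubbardTorusTT' (Ls j) t t' U) (sectorGibbsVectorTT' t t' U n (Ls j) i)).re /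
          (Ls j : ℝ) ^ 2) =
      (∑ i, sectorGibbsWeightTT' β t t' U n (Ls j) i *
        (QuantumLattice.expect (hubbardTorusTT' (Ls j) t t' U) (sectorGibbsVectorTT' t t' U n (Ls j) i)).re) /
          (Ls j : ℝ) ^ 2 := by
    rw [Finset.sum_div]
    refine Finset.sum_congr rfl fun i _ => ?_
    ring
  have halg := row_algebra_pressure hβ hLsq hP hrow hWj (card_rectTilingVecs_mul_prod_le hm (Ls j)) hA rfl
  have hε1 : β * (ε / 2) / β = ε / 2 := by field_simp
  rw [hε1] at halg
  rw [havg, henergy, one_mul]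
  linarith

/-! ### §4 The row in the thermal reader's shape -/

/-- Evaluation of an affine extra row: `Re ω_{Λ'}(r·1 − Γ E_Φ + s·Γ A) = r − e_Φ(ω) + s·Re ω(A)`. [folklore] -/
private theorem re_expect_affineRow'' (ω : InfVolFermionState 2) (t t' U : ℝ) {Λ Λ' : Finset (Site 2)}
    (hΛ : Λ ⊆ Λ') (h0 : thicken ({0} : Finset (Site 2)) 1 ⊆ Λ') (A : FermionOp Λ) (r s : ℝ) :
    (ω.expect Λ' (((r : ℝ) : ℂ) • (1 : FermionOp Λ') -
        fermionEmbed (PolySite.incl h0) ((hubbardTTPrimeFermionInteraction t t' U).meanEnergyObs 1) +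
        ((s : ℝ) : ℂ) • fermionEmbed (PolySite.incl hΛ) A)).re =
      r - ω.meanEnergy (hubbardTTPrimeFermionInteraction t t' U) 1 + s * (ω.expect Λ A).re := by
  rw [map_add, map_sub, map_smul, map_smul, ω.expect_one, ω.compatible h0, ω.compatible hΛ, meanEnergy]
  simp only [smul_eq_mul, mul_one, Complex.add_re, Complex.sub_re, Complex.ofReal_re, Complex.re_ofReal_mul]

/-- **The «ent» row with a pressure-floor input as an extra row of the thermal reader.** For every torus limit
`ω` of the canonical sector Gibbs states at `β > 0` along `Ls` (`0 ≤ n ≤ 2`), a pressure floor `W` along `Ls` as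
above, a rectangle `B = ∏[0,m_i) ⊆ Λ'` (`m_i > 0`), a Hermitian witness `G ∈ 𝔄_B`, and constants `−W/β ≤ f`,
`log Re Tr e^{−G}/(β|B|) ≤ c`:  `0 ≤ Re ω_{Λ'}((f + c)·1 − Γ E_Φ + (1/(β∏m_i))·Γ_{B⊆Λ'} G)` — the hypothesis `hG`
of `…re_expect_ge_of_thermal_certificate_symm_TT'_of_sectorGibbs` for this `G_e`, with a free-energy input `f`
in place of the ground-state energy input. [cite: Israel1979, Lemma II.3.1] [cite: ArakiMoriya2003, Theorem 3.8 and §10] -/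
theorem IsTorusLimitOfMixture.re_expect_entRow_nonneg_of_sectorGibbs_of_pressureFloor
    (t t' U : ℝ) {n : ℝ} (hn0 : 0 ≤ n) (hn2 : n ≤ 2) {β : ℝ} (hβ : 0 < β)
    {ω : InfVolFermionState 2} {Ls : ℕ → ℕ}
    (h : ω.IsTorusLimitOfMixture (sectorGibbsCount n) (fun L => sectorGibbsWeightTT' β t t' U n L)
      (fun L => sectorGibbsVectorTT' t t' U n L) Ls)
    (hLs : Tendsto Ls atTop atTop) {W : ℝ}
    (hW : ∀ ε : ℝ, 0 < ε → ∀ᶠ j in atTop,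
      (W - ε) * (Ls j : ℝ) ^ 2 ≤ Real.log (partitionFn β (sectorHamiltonianTT' t t' U n (Ls j))).re)
    {m : Fin 2 → ℕ} (hm : ∀ i, 0 < m i) {G : FermionOp (halfOpenRect m)} (hG : G.IsHermitian)
    {Λ' : Finset (Site 2)} (hB : halfOpenRect m ⊆ Λ') (h0 : thicken ({0} : Finset (Site 2)) 1 ⊆ Λ')
    {f c : ℝ} (hf : -W / β ≤ f) (hc : Real.log (partitionFn 1 G).re / (β * ∏ i, (m i : ℝ)) ≤ c) :
    0 ≤ (ω.expect Λ' ((((f + c : ℝ)) : ℂ) • (1 : FermionOp Λ') -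
        fermionEmbed (PolySite.incl h0) ((hubbardTTPrimeFermionInteraction t t' U).meanEnergyObs 1) +
        ((1 / (β * ∏ i, (m i : ℝ)) : ℝ) : ℂ) • fermionEmbed (PolySite.incl hB) G)).re := by
  rw [re_expect_affineRow'']
  have hrow := h.meanEnergy_sub_re_expect_div_le_of_sectorGibbs_box_of_pressureFloor t t' U hn0 hn2 hβ hLs hW hm hG
  linarith

/-- **Consistency: the zero-entropy cold input is a pressure floor.** For `U ≥ 0`, `0 ≤ n < 2`, `β > 0` and any
`Ls → ∞`: `W := −β·e(t,t',U,n)` satisfies the pressure-floor hypothesis (`Z_β ≥ e^{−βE₀}`, `E₀(L)/L² → e(n)`), so the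
rows of this file contain those of `TorusSectorGibbsEntropyRowLimit.lean`. [cite: Ruelle1969, §3.4]
[cite: Israel1979, Lemma II.3.1] -/
theorem eventually_pressureFloor_of_energyDensityTT' (t t' : ℝ) {U : ℝ} (hU : 0 ≤ U) {n : ℝ} (hn0 : 0 ≤ n)
    (hn2 : n < 2) {β : ℝ} (hβ : 0 < β) {Ls : ℕ → ℕ} (hLs : Tendsto Ls atTop atTop) {ε : ℝ} (hε : 0 < ε) :
    ∀ᶠ j in atTop, (-(β * energyDensityTT' t t' U n) - ε) * (Ls j : ℝ) ^ 2 ≤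
      Real.log (partitionFn β (sectorHamiltonianTT' t t' U n (Ls j))).re := by
  have h := eventually_neg_mul_le_log_partitionFn_sectorHamiltonianTT' t t' hU hn0 hn2 hβ.le hLs
    (ε := ε / β) (div_pos hε hβ)
  filter_upwards [h] with j hj
  have e : -(β * (energyDensityTT' t t' U n + ε / β)) = -(β * energyDensityTT' t t' U n) - ε := by
    field_simp; ring
  rwa [e] at hj

end InfVolFermionState

end Limit

end Literature.MathematicalPhysics.QuantumLattice

end
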